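import Summits.Ventures.PackingBounds.Configurations.ListConfig
import Summits.Ventures.PackingBounds.Configurations.SectionTransfer
import Summits.Ventures.PackingBounds.Configurations.Icosahedron
import Summits.Ventures.PackingBounds.Energy.UniversalOptimalityPolygon5

/-!
# The regular pentagon as an explicit section over `ℤ[√5]`: ground-state energy of `5` points on `S¹`

Framing: lottery ticket; floor = certified bounds/negative ranges. Venture `PackingBounds` (cell
`pub-packcert`, seat `pub-packcert-energy`) — the **attained side** for `(n, N) = (2, 5)`.

`vecs` lists the five vectors `(4 cos(2π(j-k)/5))_{j<5}` of `ℝ⁵` (`k < 5`), with coordinates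
`4, √5-1, -√5-1` in `ℤ[√5]`: a regular pentagon (Gram matrix `40 cos(2π(k-l)/5)`) lying in the plane
orthogonal to `(1,1,1,1,1)`, `(4cos(4πj/5))_j` and `(sin(4πj/5)/sin 36°)_j = (0, 2, -1-√5, 1+√5, -2)/…`
(all in `ℤ[√5]⁵`, pairwise orthogonal). The kernel checks the distance distribution
`cos 72° = (√5-1)/4` (twice), `cos 144° = -(√5+1)/4` (twice) and the orthogonality; `Config.exists_section`
moves the pentagon to `ℝ²`. With the cell's universal optimality of the pentagon on `S¹`
(`Energy.UniversalPolygon5…`, via the Chebyshev LP bound `CircleEnergyLP`) this gives the ground-state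
energy of `5` points on the circle for every absolutely monotonic potential (`energy_isLeast`).

## References
* H. Cohn, A. Kumar, J. Amer. Math. Soc. 20 (2007) 99–148, Table 1 (regular polygons). [`CohnKumar2006`]
-/

namespace Summit.Ventures.PackingBounds.Config.Pentagon

open Finset Summit.Ventures.PackingBounds.Config

open Summit.Ventures.PackingBounds.Config.Icosahedron (h5 d5_not_square)

/-- `(√5)² = 5`. -/
private theorem hX : Real.sqrt 5 ^ 2 = 5 := Real.sq_sqrt (by norm_num)

/-- `2.236 < √5`. -/
private theorem hlo : (2.236 : ℝ) < Real.sqrt 5 := (Real.lt_sqrt (by norm_num)).mpr (by norm_num)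

/-- `√5 < 2.2361`. -/
private theorem hhi : Real.sqrt 5 < 2.2361 := (Real.sqrt_lt' (by norm_num)).mpr (by norm_num)

set_option maxHeartbeats 4000000 in
/-- The pentagon vectors `(4cos(2π(j-k)/5))_j` over `ℤ[√5]`. [cite: CohnKumar2006, Table 1] -/
def vecs : List (List (Zsqrtd 5)) := [
  [⟨4, 0⟩, ⟨-1, 1⟩, ⟨-1, -1⟩, ⟨-1, -1⟩, ⟨-1, 1⟩],
  [⟨-1, 1⟩, ⟨4, 0⟩, ⟨-1, 1⟩, ⟨-1, -1⟩, ⟨-1, -1⟩],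
  [⟨-1, -1⟩, ⟨-1, 1⟩, ⟨4, 0⟩, ⟨-1, 1⟩, ⟨-1, -1⟩],
  [⟨-1, -1⟩, ⟨-1, -1⟩, ⟨-1, 1⟩, ⟨4, 0⟩, ⟨-1, 1⟩],
  [⟨-1, 1⟩, ⟨-1, -1⟩, ⟨-1, -1⟩, ⟨-1, 1⟩, ⟨4, 0⟩]]

/-- The distance table: dot products of a member with the other members, with multiplicities. -/
def table : List ((Zsqrtd 5) × ℕ) := [(⟨-10, -10⟩, 2), (⟨-10, 10⟩, 2)]

/-- Kernel check: `5` coordinate lists. -/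
theorem length_vecs : vecs.length = 5 := by decide +kernel

set_option maxRecDepth 100000 in
/-- Kernel check: every list has length `5` and the prescribed squared length. -/
private theorem shape_vecs : shapeOK vecs 5 (⟨40, 0⟩ : (Zsqrtd 5)) = true := by decide +kernel

/-- Kernel check: the table keys are distinct and differ from the squared length. -/
private theorem keys_table : keysOK table (⟨40, 0⟩ : (Zsqrtd 5)) = true := by decide +kernel

set_option maxRecDepth 100000 in
/-- Kernel check (the distance distribution): the dot products of every member with the other members
have exactly the tabulated multiplicities and take no other value. -/
private theorem hist_vecs : histOK vecs table vecs = true := by decide +kernel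

/-- The coordinate lists are pairwise distinct (from the checks). -/
private theorem nodup_vecs : vecs.Nodup := nodup_of_checks shape_vecs keys_table hist_vecs


/-- The normal vectors cutting out the `2`-dimensional subspace containing the configuration
(pairwise orthogonal, nonzero). -/
def normals : List (List (Zsqrtd 5)) := [
  [⟨1, 0⟩, ⟨1, 0⟩, ⟨1, 0⟩, ⟨1, 0⟩, ⟨1, 0⟩],
  [⟨4, 0⟩, ⟨-1, -1⟩, ⟨-1, 1⟩, ⟨-1, 1⟩, ⟨-1, -1⟩],
  [⟨0, 0⟩, ⟨2, 0⟩, ⟨-1, -1⟩, ⟨1, 1⟩, ⟨-2, 0⟩]]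

/-- Kernel check: the normals have length `5`, are nonzero and pairwise orthogonal. -/
private theorem normals_ok : normalsOK normals 5 = true := by decide +kernel

set_option maxRecDepth 100000 in
/-- Kernel check: every member of the configuration is orthogonal to every normal. -/
private theorem orth_ok : orthOK normals vecs = true := by decide +kernel

/-- `ι q > 0`. -/
private theorem hq : 0 < (Zsqrtd.toReal h5) (⟨40, 0⟩ : (Zsqrtd 5)) := by
  rw [Zsqrtd.toReal_apply]; push_cast; nlinarith [Real.sqrt_nonneg 5, hX]

/-- Node value `ι d / ι q` for the table key number `0`. -/
private theorem key_0 : (Zsqrtd.toReal h5) (⟨-10, -10⟩ : (Zsqrtd 5)) / (Zsqrtd.toReal h5) (⟨40, 0⟩ : (Zsqrtd 5)) = ((-1 / 4 : ℝ) + (-1 / 4 : ℝ) * Real.sqrt 5 : ℝ) := by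
  rw [div_eq_iff hq.ne', Zsqrtd.toReal_apply, Zsqrtd.toReal_apply]
  push_cast
  linear_combination (0 : ℝ) * hX

/-- Node value `ι d / ι q` for the table key number `1`. -/
private theorem key_1 : (Zsqrtd.toReal h5) (⟨-10, 10⟩ : (Zsqrtd 5)) / (Zsqrtd.toReal h5) (⟨40, 0⟩ : (Zsqrtd 5)) = ((-1 / 4 : ℝ) + (1 / 4 : ℝ) * Real.sqrt 5 : ℝ) := by
  rw [div_eq_iff hq.ne', Zsqrtd.toReal_apply, Zsqrtd.toReal_apply]
  push_cast
  linear_combination (0 : ℝ) * hX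

/-- **The configuration in `ℝ^2`**: `5` unit vectors of `ℝ^2` with pairwise inner products
`≤ (-1 / 4 : ℝ) + (1 / 4 : ℝ) * Real.sqrt 5` (the tabulated values) and, for every potential `a`, `a`-energy equal to the tabulated
value (section of the ambient list configuration, moved to `ℝ^2` by `Config.exists_section`). -/
theorem exists_config : ∃ C : Finset (EuclideanSpace ℝ (Fin 2)), C.card = 5 ∧ (∀ x ∈ C, ‖x‖ = 1) ∧
    (∀ x ∈ C, ∀ y ∈ C, x ≠ y → inner ℝ x y ≤ (-1 / 4 : ℝ) + (1 / 4 : ℝ) * Real.sqrt 5) ∧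
    ∀ a : ℝ → ℝ, ∑ x ∈ C, ∑ y ∈ C.erase x, a (inner ℝ x y) =
      (5 : ℝ) * (2 * a ((-1 / 4 : ℝ) + (-1 / 4 : ℝ) * Real.sqrt 5) + 2 * a ((-1 / 4 : ℝ) + (1 / 4 : ℝ) * Real.sqrt 5)) := by
  obtain ⟨C, hc, hn, hi, he⟩ := exists_section (Zsqrtd.toReal_injective h5 d5_not_square) hq shape_vecs keys_table hist_vecs
    nodup_vecs normals normals_ok orth_ok (n := 2) (by decide)
  refine ⟨C, by rw [hc, length_vecs], hn, fun x hx y hy hxy => ?_, fun a => ?_⟩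
  · obtain ⟨p, hp, hpe⟩ := hi x hx y hy hxy
    rw [hpe]
    simp only [table, List.mem_cons, List.not_mem_nil, or_false] at hp
    rcases hp with rfl | rfl
    · rw [key_0]; nlinarith [hlo]
    · rw [key_1]
  · rw [he a, length_vecs]
    simp only [table, List.map_cons, List.map_nil, List.sum_cons, List.sum_nil, Nat.cast_ofNat]
    rw [key_0, key_1]
    ring

/-- **Ground-state energy of `5` points on `S¹`** for every absolutely monotonic potential: the regular pentagon (universal optimality lower bound + attained). [cite: CohnKumar2006, Theorem 1.2] -/
theorem energy_isLeast (a : ℝ → ℝ) (ha : AbsolutelyMonotoneOn a (Set.Ico (-1) 1)) :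
    IsLeast {E : ℝ | ∃ C : Finset (EuclideanSpace ℝ (Fin 2)), (∀ x ∈ C, ‖x‖ = 1) ∧ C.card = 5 ∧
      E = ∑ x ∈ C, ∑ y ∈ C.erase x, a (inner ℝ x y)}
      ((5 : ℝ) * (2 * a ((-1 / 4 : ℝ) + (-1 / 4 : ℝ) * Real.sqrt 5) + 2 * a ((-1 / 4 : ℝ) + (1 / 4 : ℝ) * Real.sqrt 5))) := by
  obtain ⟨C, hc, hn, _, he⟩ := exists_config
  refine ⟨⟨C, hn, hc, (he a).symm⟩, ?_⟩
  rintro E ⟨C', h1, hN, rfl⟩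
  exact Energy.UniversalPolygon5.universallyOptimal_of_absolutelyMonotoneOn a ha C' h1 hN

end Summit.Ventures.PackingBounds.Config.Pentagon
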